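import Summits.Parity.GeneralizedHardyLittlewood.Theorems.LeeYangFibresRelativeDimOneDefs

/-!
# Route `LeeYangFibres`, crux `RelativeDimOne` (stmt-Parity-14113), line `SketchIdeator1`:
B3 — degenerate shifts are few (`stub_degenerateCount : DegenerateCount`)

For a non-degenerate `t`-system `Ψ` of one-dimensional forms `ψ_i(n) = A_i n + B_i` and a shift
`H ∈ ℤ^m`, the translate-constellation `Ψ^{(H)} = Ψ ⊔ (Ψ + H₁) ⊔ ⋯ ⊔ (Ψ + H_m)`
(`translateFamily Ψ H`, shift vector `H' = (0, H₁, …, H_m) = shiftVec H`) has the same (non-zero)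
coefficient vectors as `Ψ`, and two of its forms `ψ_i(· + H'_j)`, `ψ_{i'}(· + H'_{j'})` are rational
multiples of each other only if `j ≠ j'` and
`A_i A_{i'} (H'_j − H'_{j'}) = A_i B_{i'} − A_{i'} B_i` (`exists_hyperplane_of_degenerate`).
Each such hyperplane meets the shift box `[-2N, 2N]^m` in at most `(4N+1)^{m-1}` points (one
coordinate is determined by the others, `card_filter_hyperplane_le`), and there are at most
`m (m+1) t²` index tuples, whence
`#{H ∈ [-2N,2N]^m : Ψ^{(H)} degenerate} ≤ m (m+1) t² (4N+1)^{m-1}` (`stub_degenerateCount`).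

Reference: B. Green, T. Tao, *Linear equations in primes*, Ann. of Math. 171 (2010), Def. 1.1
[GreenTao2010] (the non-degeneracy condition).
-/

noncomputable section

open scoped BigOperators Classical Topology
open Finset Filter MeasureTheory Literature.NumberTheory.Sieve

namespace Summit.Parity.GeneralizedHardyLittlewood.Cruxes.RelativeDimOne.TranslateAmplification

variable {t m : ℕ}

/-- The value of the form `(j, i)` of `Ψ^{(H)}` at `n`: `A_i n₀ + B_i + A_i H'_j`. -/
theorem translateFamily_eval (Ψ : Fin t → AffLinForm 1) (H : Fin m → ℤ) (j : Fin (m + 1))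
    (i : Fin t) (n : Fin 1 → ℤ) :
    (translateFamily Ψ H (finProdFinEquiv (j, i))).eval n =
      (Ψ i).coeff 0 * n 0 + (Ψ i).const + (Ψ i).coeff 0 * shiftVec H j := by
  rw [translateFamily_apply]
  simp only [translateForm, AffLinForm.eval, Fin.sum_univ_one]
  ring

/-- In dimension one a non-degenerate system has non-zero leading coefficients `A_i ≠ 0`. -/
theorem coeff_zero_ne_zero {Ψ : Fin t → AffLinForm 1} (hΨ : IsNondegenerateSystem Ψ) (i : Fin t) :
    (Ψ i).coeff 0 ≠ 0 := fun h =>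
  hΨ.1 i (funext fun l => by rw [Subsingleton.elim l 0]; exact h)

/-- KEY ALGEBRAIC STEP. If `Ψ` is non-degenerate but `Ψ^{(H)}` is degenerate, then `H` lies on one
of the hyperplanes `A_i A_{i'} (H_{j₀} − H'_{j'}) = A_i B_{i'} − A_{i'} B_i` with `j' ≠ j₀ + 1`:
a proportionality `a ψ_i(· + H'_j) = b ψ_{i'}(· + H'_{j'})` with `(a, b) ≠ (0, 0)` forces, comparing
the values at `n = 0` and `n = 1`, `a A_i = b A_{i'}` (so `a ≠ 0`) and then
`A_i A_{i'} (H'_j − H'_{j'}) = A_i B_{i'} − A_{i'} B_i`; if `j = j'` this says `A_{i'} ψ_i = A_i ψ_{i'}`,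
contradicting the non-degeneracy of `Ψ`, so `j ≠ j'` and one of `j, j'` is a successor. -/
theorem exists_hyperplane_of_degenerate (Ψ : Fin t → AffLinForm 1) (hΨ : IsNondegenerateSystem Ψ)
    (H : Fin m → ℤ) (hH : ¬ IsNondegenerateSystem (translateFamily Ψ H)) :
    ∃ j₀ : Fin m, ∃ j' : Fin (m + 1), ∃ i i' : Fin t, j' ≠ j₀.succ ∧
      (Ψ i).coeff 0 * (Ψ i').coeff 0 * (H j₀ - shiftVec H j') =
        (Ψ i).coeff 0 * (Ψ i').const - (Ψ i').coeff 0 * (Ψ i).const := by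
  have hA := coeff_zero_ne_zero hΨ
  -- the symmetric form of the conclusion
  suffices key : ∃ j j' : Fin (m + 1), ∃ i i' : Fin t, j ≠ j' ∧
      (Ψ i).coeff 0 * (Ψ i').coeff 0 * (shiftVec H j - shiftVec H j') =
        (Ψ i).coeff 0 * (Ψ i').const - (Ψ i').coeff 0 * (Ψ i).const by
    obtain ⟨j, j', i, i', hjj', hEq⟩ := key
    cases j using Fin.cases with
    | zero =>
      obtain ⟨j₀, rfl⟩ := Fin.exists_succ_eq.mpr hjj'.symm
      refine ⟨j₀, 0, i', i, hjj', ?_⟩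
      rw [shiftVec_succ, shiftVec_zero] at hEq
      rw [shiftVec_zero]
      linear_combination (-1 : ℤ) * hEq
    | succ j₀ =>
      refine ⟨j₀, j', i, i', fun h => hjj' h.symm, ?_⟩
      rw [shiftVec_succ] at hEq
      exact hEq
  unfold IsNondegenerateSystem at hH
  rw [not_and_or] at hH
  rcases hH with h1 | h2
  · exact absurd (fun k => hΨ.1 (finProdFinEquiv.symm k).2) h1
  push Not at h2
  obtain ⟨k, k', hkk', a, b, hab, hab0⟩ := h2
  obtain ⟨⟨j, i⟩, rfl⟩ := finProdFinEquiv.surjective k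
  obtain ⟨⟨j', i'⟩, rfl⟩ := finProdFinEquiv.surjective k'
  have e1 := hab 0
  have e2 := hab fun _ => 1
  simp only [translateFamily_eval, Pi.zero_apply, mul_zero, zero_add, mul_one] at e1 e2
  have e3 : a * (Ψ i).coeff 0 = b * (Ψ i').coeff 0 := by linear_combination e2 - e1
  have ha : a ≠ 0 := by
    intro ha0
    rw [ha0, zero_mul] at e3
    rcases mul_eq_zero.mp e3.symm with hb | hA0
    · exact hab0 ha0 hb
    · exact hA i' hA0
  have star : (Ψ i).coeff 0 * (Ψ i').coeff 0 * (shiftVec H j - shiftVec H j') =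
      (Ψ i).coeff 0 * (Ψ i').const - (Ψ i').coeff 0 * (Ψ i).const := by
    refine mul_left_cancel₀ ha ?_
    linear_combination (Ψ i').coeff 0 * e1 - ((Ψ i').coeff 0 * shiftVec H j' + (Ψ i').const) * e3
  refine ⟨j, j', i, i', ?_, star⟩
  rintro rfl
  have hii' : i ≠ i' := fun h => hkk' (by rw [h])
  rw [sub_self, mul_zero] at star
  refine hA i' (hΨ.2 i i' hii' ((Ψ i').coeff 0) ((Ψ i).coeff 0) fun n => ?_).1
  simp only [AffLinForm.eval, Fin.sum_univ_one]
  linear_combination star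

/-- COUNTING ONE HYPERPLANE. For `c ≠ 0` and `j' ≠ j₀ + 1`, the shifts `H ∈ [-2N, 2N]^{m₀+1}` with
`c (H_{j₀} − H'_{j'}) = D` number at most `(4N+1)^{m₀}`: the coordinate `H_{j₀}` is determined by the
others (`H'_{j'}` is `0` or another coordinate), so `H ↦ (H_l)_{l ≠ j₀}` is injective on them. -/
theorem card_filter_hyperplane_le (m₀ N : ℕ) {c : ℤ} (hc : c ≠ 0) (D : ℤ) (j₀ : Fin (m₀ + 1))
    (j' : Fin (m₀ + 1 + 1)) (hj : j' ≠ j₀.succ) :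
    ((shiftBox (m₀ + 1) N).filter (fun H => c * (H j₀ - shiftVec H j') = D)).card ≤
      (4 * N + 1) ^ m₀ := by
  have hT : (Fintype.piFinset fun _ : Fin m₀ => Finset.Icc (-(2 * N : ℤ)) (2 * N)).card =
      (4 * N + 1) ^ m₀ := by
    rw [Fintype.card_piFinset_const, Int.card_Icc]
    congr 1
    omega
  rw [← hT]
  refine Finset.card_le_card_of_injOn (fun H => Fin.removeNth j₀ H) ?_ ?_
  · intro H hH
    rw [Finset.mem_coe, Finset.mem_filter, shiftBox, Fintype.mem_piFinset] at hH
    rw [Finset.mem_coe, Fintype.mem_piFinset]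
    exact fun k => hH.1 (j₀.succAbove k)
  · intro H₁ hH₁ H₂ hH₂ hEq
    rw [Finset.mem_coe, Finset.mem_filter] at hH₁ hH₂
    have hrem : ∀ k : Fin m₀, H₁ (j₀.succAbove k) = H₂ (j₀.succAbove k) := fun k =>
      congr_fun hEq k
    have hsv : shiftVec H₁ j' = shiftVec H₂ j' := by
      cases j' using Fin.cases with
      | zero => rw [shiftVec_zero, shiftVec_zero]
      | succ j₁ =>
        rw [shiftVec_succ, shiftVec_succ]
        have hne : j₁ ≠ j₀ := fun h => hj (by rw [h])
        obtain ⟨k, rfl⟩ := Fin.exists_succAbove_eq hne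
        exact hrem k
    have h0 : H₁ j₀ = H₂ j₀ := by
      have h := hH₁.2.trans hH₂.2.symm
      rw [hsv] at h
      exact sub_left_inj.mp (mul_left_cancel₀ hc h)
    funext l
    rcases Fin.eq_self_or_eq_succAbove j₀ l with rfl | ⟨k, rfl⟩
    · exact h0
    · exact hrem k

/-- **B3 holds**: for non-degenerate `Ψ`, the shifts `H ∈ [-2N,2N]^m` with `Ψ^{(H)}` degenerate
number at most `m (m+1) t² (4N+1)^{m-1}`: the degenerate shifts lie on the union over the index
tuples `(j₀, j', i, i')` of the hyperplanes of `exists_hyperplane_of_degenerate`, each of which has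
at most `(4N+1)^{m-1}` points in the box (`card_filter_hyperplane_le`). For `m = 0` there are no
degenerate shifts at all. [cite: GreenTao2010, Def. 1.1] -/
theorem stub_degenerateCount : DegenerateCount := by
  intro m t
  cases m with
  | zero =>
    refine ⟨0, fun N Ψ hΨ => ?_⟩
    have h0 : ∀ H ∈ shiftBox 0 N, ¬¬IsNondegenerateSystem (translateFamily Ψ H) :=
      fun H _ hH => (exists_hyperplane_of_degenerate Ψ hΨ H hH).elim fun j₀ _ => j₀.elim0
    rw [Finset.filter_false_of_mem h0]
    simp
  | succ m₀ =>
    refine ⟨(((m₀ + 1) * (m₀ + 1 + 1) * (t * t) : ℕ) : ℝ), fun N Ψ hΨ => ?_⟩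
    have hA := coeff_zero_ne_zero hΨ
    -- the hyperplane slices of the shift box, indexed by `(j₀, j', i, i')`
    set slice : (Fin (m₀ + 1) × Fin (m₀ + 1 + 1)) × (Fin t × Fin t) → Finset (Fin (m₀ + 1) → ℤ) :=
      fun x => (shiftBox (m₀ + 1) N).filter (fun H => x.1.2 ≠ x.1.1.succ ∧
        (Ψ x.2.1).coeff 0 * (Ψ x.2.2).coeff 0 * (H x.1.1 - shiftVec H x.1.2) =
          (Ψ x.2.1).coeff 0 * (Ψ x.2.2).const - (Ψ x.2.2).coeff 0 * (Ψ x.2.1).const) with hslice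
    -- every slice is small
    have hcard : ∀ x, (slice x).card ≤ (4 * N + 1) ^ m₀ := by
      rintro ⟨⟨j₀, j'⟩, ⟨i, i'⟩⟩
      rw [hslice]
      dsimp only
      by_cases hj : j' = j₀.succ
      · rw [Finset.filter_false_of_mem, Finset.card_empty]
        · exact Nat.zero_le _
        · exact fun H _ h => h.1 hj
      · refine le_trans (Finset.card_le_card fun H hH => ?_)
          (card_filter_hyperplane_le m₀ N (mul_ne_zero (hA i) (hA i'))
            ((Ψ i).coeff 0 * (Ψ i').const - (Ψ i').coeff 0 * (Ψ i).const) j₀ j' hj)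
        rw [Finset.mem_filter] at hH ⊢
        exact ⟨hH.1, hH.2.2⟩
    -- the degenerate shifts lie on the slices
    have hnat : ((shiftBox (m₀ + 1) N).filter
        (fun H => ¬ IsNondegenerateSystem (translateFamily Ψ H))).card ≤
        (m₀ + 1) * (m₀ + 1 + 1) * (t * t) * (4 * N + 1) ^ m₀ := by
      calc ((shiftBox (m₀ + 1) N).filter
              (fun H => ¬ IsNondegenerateSystem (translateFamily Ψ H))).card
          ≤ (Finset.univ.biUnion slice).card := by
            refine Finset.card_le_card fun H hH => ?_
            rw [Finset.mem_filter] at hH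
            obtain ⟨j₀, j', i, i', hj, hEq⟩ := exists_hyperplane_of_degenerate Ψ hΨ H hH.2
            rw [Finset.mem_biUnion]
            refine ⟨((j₀, j'), (i, i')), Finset.mem_univ _, ?_⟩
            rw [hslice]
            dsimp only
            rw [Finset.mem_filter]
            exact ⟨hH.1, hj, hEq⟩
        _ ≤ ∑ x, (slice x).card := Finset.card_biUnion_le
        _ ≤ ∑ _x : (Fin (m₀ + 1) × Fin (m₀ + 1 + 1)) × (Fin t × Fin t), (4 * N + 1) ^ m₀ :=
            Finset.sum_le_sum fun x _ => hcard x
        _ = (m₀ + 1) * (m₀ + 1 + 1) * (t * t) * (4 * N + 1) ^ m₀ := by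
            rw [Finset.sum_const, Finset.card_univ, smul_eq_mul]
            simp only [Fintype.card_prod, Fintype.card_fin]
    rw [Nat.add_sub_cancel]
    exact_mod_cast hnat

end Summit.Parity.GeneralizedHardyLittlewood.Cruxes.RelativeDimOne.TranslateAmplification
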